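/-
Copyright (c) 2026 the pub-hodgecm-mathlib formalisation cell (harness21).  Prover seat hodgecm-mathlib-A-p19 (g21), D-T road (Tamagawa ∕ (K7-s)),
brick B2a «D-T3′-def, the top-form Haar measure of an archimedean centraliser, by frames» (LEAD F0P3a-plan (g9) WORDS T8-6 ∕ T8-16 (D), 2026-09-01).
-/
import Literature.NumberTheory.Weil1964.UnitaryArchTopFormHaarCongr
import Literature.NumberTheory.Automorphic.UnitaryGroupBlockCentralizer
import HarnessLib

/-!
# The top-form Haar measure on the archimedean centraliser of a singular semisimple element of `U(H)(L⁺ ⊗ ℝ)`, by frames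
# (Rogawski 1990 §3.8 Prop. 3.8.1 (a) «`G_γ ≅ U(2) × U(1)`-type», §1.7 p. 6 «compatible measures»; Helgason 2000 Ch. I §1)

Topic `NumberTheory/Weil1964`; namespace `Literature.NumberTheory.Weil1964.UnitaryArchTopForm`.  DEFINITIONS WITH BODIES (`archBlockDiag`, `archFrameEmbedding`,
`centralizerMeasureOfFrame`, `IsSingularArchFrame`, `centralizerTopFormHaar`) + proved theorems; no named fact (net debt 0), no instance, no notation, no `sorry`.
Cell `pub/hodgecm-mathlib`, crux H413 = `stmt-HodgeConjecture-24833`; D-T road row «D-T3′», brick B2a (census `CENSUS-B2-ArchSingularCentralizerTopFormHaar` 2aaa130ebe3bf25a,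
adopted LEAD T8-6 «=»), over ★ B1 `UnitaryArchTopFormHaar`, ★ B1′ `…HaarCM`, ★ B1″ `…HaarTransport` ∕ `…HaarCongr` (p840120) and ★ `UnitaryGroupBlockCentralizer`
(`finSum_commute_finSum_smul_one`; its `mem_range_blockDiagFin_iff_commute` is read by the sequel B2b).

THE OBJECT.  For a singular semisimple `γ ∈ U(H)(L⁺ ⊗ ℝ)` with an archimedean FRAME — `T ∈ GL₃(L ⊗ ℝ)`, rational hermitian non-degenerate `H_a ∈ M₂(L)`,
`H_b ∈ M₁(L)` and `a ≠ b ∈ L` with `σ(T)ᵀ H′ T = (H_a ⊕ᶠ H_b)′` and `γ T = T (a·1 ⊕ᶠ b·1)′` (`′ = archFormOf`; the RATIONAL frames of ★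
`Rogawski1990/SingularSemisimpleElement.exists_singular_frame_of_isSemisimpleElt` base-changed by `mixedEmbedding`, and their `U(H)(L⁺ ⊗ ℝ)`-conjugates) — the
centraliser `Z(γ)` is the image of `U(H_a)(L⁺ ⊗ ℝ) × U(H_b)(L⁺ ⊗ ℝ)` under `(u_a, u_b) ↦ T (u_a ⊕ u_b) T⁻¹` (`archFrameEmbedding`; range = `Z(γ)` in the sequel B2b),
a topological-group isomorphism onto `Z(γ)` (sequel B2b); `centralizerTopFormHaar γ` is the image of
`archTopFormHaar H_a ⊗ archTopFormHaar H_b` = `|ω_std|_{M₂} ⊗ |ω_std|_{M₁}` on `Z(γ)` (print's «compatible measure» on `G_γ(ℝ) ≅ U(h)(ℝ) × U(1)`, [Rogawski1990 §1.7,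
§3.8]).  FRAME INDEPENDENCE (two frames of `γ` differ by block congruences `K_a ⊕ K_b`, under which `archTopFormHaar` is transported, ★ `map_archTopFormHaar_of_conj`)
and the Haar property are the sequel B2b (theorems only); here: the definitions, their unfoldings, and the frame-free consequences.
* §1 (generic `F, E, c`, sizes `N₁ + N₂`) `archFormOf_finSum`, `arch_finSum_le` ∕ `_ge`, **`archBlockDiag`** (`(u₁, u₂) ↦ u₁ ⊕ᶠ u₂` into `U(J₁ ⊕ᶠ J₂)(E ⊗ ℝ)`),
  `coe_archBlockDiag`, `coe_coe_archBlockDiag` (matrix `= finSum ↑u₁ ↑u₂`), `archBlockDiag_injective`, `continuous_archBlockDiag`.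
* §2 **`archFrameEmbedding T hT`** (`= (T · T⁻¹) ∘ archBlockDiag` for `σ(T)ᵀ J′ T = (J₁ ⊕ᶠ J₂)′`, ★ `unitaryGroupOfFormCongrOfEq`), `coe_archFrameEmbedding`,
  `archFrameEmbedding_injective`, `continuous_archFrameEmbedding`, `archFrameEmbedding_mem_centralizer` (for `γ T = T (a·1 ⊕ᶠ b·1)`); the range statement
  `Z(γ) = T (U(J₁) × U(J₂)) T⁻¹` (★ `mem_range_blockDiagFin_iff_commute`) and the `≃ₜ*` with formula (open mapping) are in the sequel B2b (theorems only).
* §3 **`centralizerMeasureOfFrame T hT γ hγ μ₁ μ₂ : Measure Z(γ)`** := `map (u ↦ ⟨archFrameEmbedding T hT u, _⟩) (μ₁ ⊗ μ₂)`, `centralizerMeasureOfFrame_def`.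
* §4 (CM, `N = 2 + 1`) **`IsSingularArchFrame L H γ a b T H_a H_b`** (the frame facts as one `Prop`), **`centralizerTopFormHaar L H γ`** := the frame measure of
  `archTopFormHaar H_a ⊗ archTopFormHaar H_b` for a CHOSEN frame when one exists (Borel structures on the blocks by `borel`), `0` otherwise — the junk branch is never
  read by (K7-s), which quantifies over singular non-central classes only; `isSingularArchFrame_iff`.
HONEST SCOPE.  Group theory and measure push-forwards; no volume is computed.  HC_CM is proved only modulo the printed citations until rung 0 closes; this file discharges no
printed statement — it NAMES the measure the relative identity (K7-s) [Rogawski1990 §14.5 p. 239; Kottwitz1988 Prop. 2] speaks about at `∞`.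

## References
* J. D. Rogawski, *Automorphic Representations of Unitary Groups in Three Variables*, Ann. of Math. Stud. 123 (1990), §1.7 p. 6, §3.8 Prop. 3.8.1 (a) p. 27,
  §14.5 Lemma 14.5.2 (b) pp. 238–239. [Rogawski1990]
* S. Helgason, *Groups and Geometric Analysis*, AMS Math. Surveys Monogr. 83 (2000), Ch. I §1 Thm. 1.14 p. 96. [Helgason2000]
-/

set_option autoImplicit false

noncomputable section

open NumberField NumberField.mixedEmbedding NumberField.InfinitePlace Set Filter Topology MeasureTheory MeasureTheory.Measure
open Literature.NumberTheory.Automorphic Literature.NumberTheory.Automorphic.UnitaryGroup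
open scoped Classical Matrix MatrixGroups ENNReal NNReal

namespace Literature.NumberTheory.Weil1964

namespace UnitaryArchTopForm

/-! ## §1 The archimedean block-diagonal embedding `U(J₁)(E ⊗ ℝ) × U(J₂)(E ⊗ ℝ) →* U(J₁ ⊕ᶠ J₂)(E ⊗ ℝ)` -/

section BlockDiag

variable (F E : Type) [Field F] [Field E] [Algebra F E] (c : E ≃ₐ[F] E) {N₁ N₂ : ℕ}
  (J₁ : Matrix (Fin N₁) (Fin N₁) E) (J₂ : Matrix (Fin N₂) (Fin N₂) E)

/-- `(J₁ ⊕ᶠ J₂)′ = J₁′ ⊕ᶠ J₂′` for `′ = archFormOf` (★ `finSum_map` at `mixedEmbedding`). [cite: Rogawski1990, §3.8 Prop. 3.8.1 p. 27] -/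
theorem archFormOf_finSum : archFormOf E (N₁ + N₂) (finSum N₁ N₂ J₁ J₂) = finSum N₁ N₂ (archFormOf E N₁ J₁) (archFormOf E N₂ J₂) :=
  finSum_map (mixedEmbedding E) J₁ J₂

/-- `U(J₁′ ⊕ᶠ J₂′) ≤ U((J₁ ⊕ᶠ J₂)′)` (equal subgroups of `GL_{N₁+N₂}(E ⊗ ℝ)`). [cite: Rogawski1990, §3.8 Prop. 3.8.1 p. 27] -/
theorem arch_finSum_ge :
    unitaryGroupOfForm (conjMixed F E c) (finSum N₁ N₂ (archFormOf E N₁ J₁) (archFormOf E N₂ J₂)) ≤ arch F E c (N₁ + N₂) (finSum N₁ N₂ J₁ J₂) := by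
  change unitaryGroupOfForm (conjMixed F E c) _ ≤ unitaryGroupOfForm (conjMixed F E c) (archFormOf E (N₁ + N₂) (finSum N₁ N₂ J₁ J₂))
  rw [archFormOf_finSum]

/-- `U((J₁ ⊕ᶠ J₂)′) ≤ U(J₁′ ⊕ᶠ J₂′)` (equal subgroups of `GL_{N₁+N₂}(E ⊗ ℝ)`). [cite: Rogawski1990, §3.8 Prop. 3.8.1 p. 27] -/
theorem arch_finSum_le :
    arch F E c (N₁ + N₂) (finSum N₁ N₂ J₁ J₂) ≤ unitaryGroupOfForm (conjMixed F E c) (finSum N₁ N₂ (archFormOf E N₁ J₁) (archFormOf E N₂ J₂)) := by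
  change unitaryGroupOfForm (conjMixed F E c) (archFormOf E (N₁ + N₂) (finSum N₁ N₂ J₁ J₂)) ≤ unitaryGroupOfForm (conjMixed F E c) _
  rw [archFormOf_finSum]

/-- **The archimedean block-diagonal embedding** `U(J₁)(E ⊗ ℝ) × U(J₂)(E ⊗ ℝ) →* U(J₁ ⊕ᶠ J₂)(E ⊗ ℝ)`, `(u₁, u₂) ↦ u₁ ⊕ᶠ u₂` (★ `blockDiagFin` at `σ = c ⊗ 1` read through
`archFormOf_finSum`). [cite: Rogawski1990, §3.8 Prop. 3.8.1 p. 27] -/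
def archBlockDiag : arch F E c N₁ J₁ × arch F E c N₂ J₂ →* arch F E c (N₁ + N₂) (finSum N₁ N₂ J₁ J₂) :=
  (Subgroup.inclusion (arch_finSum_ge F E c J₁ J₂)).comp (blockDiagFin (conjMixed F E c) (archFormOf E N₁ J₁) (archFormOf E N₂ J₂))

/-- `archBlockDiag (u₁, u₂)` in `GL`: `reindexGL finSumFinEquiv (blockDiagGL (u₁, u₂))`. [cite: Rogawski1990, §3.8 Prop. 3.8.1 p. 27] -/
theorem coe_archBlockDiag (u : arch F E c N₁ J₁ × arch F E c N₂ J₂) :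
    ((archBlockDiag F E c J₁ J₂ u : arch F E c (N₁ + N₂) (finSum N₁ N₂ J₁ J₂)) : GL (Fin (N₁ + N₂)) (mixedSpace E)) =
      reindexGL finSumFinEquiv (blockDiagGL ((u.1 : GL (Fin N₁) (mixedSpace E)), (u.2 : GL (Fin N₂) (mixedSpace E)))) :=
  rfl

/-- The matrix of `archBlockDiag (u₁, u₂)` is `↑u₁ ⊕ᶠ ↑u₂`. [cite: Rogawski1990, §3.8 Prop. 3.8.1 p. 27] -/
theorem coe_coe_archBlockDiag (u : arch F E c N₁ J₁ × arch F E c N₂ J₂) :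
    (((archBlockDiag F E c J₁ J₂ u : arch F E c (N₁ + N₂) (finSum N₁ N₂ J₁ J₂)) : GL (Fin (N₁ + N₂)) (mixedSpace E)) :
        Matrix (Fin (N₁ + N₂)) (Fin (N₁ + N₂)) (mixedSpace E)) =
      finSum N₁ N₂ ((u.1 : GL (Fin N₁) (mixedSpace E)) : Matrix (Fin N₁) (Fin N₁) (mixedSpace E))
        ((u.2 : GL (Fin N₂) (mixedSpace E)) : Matrix (Fin N₂) (Fin N₂) (mixedSpace E)) := by
  change (((blockDiagFin (conjMixed F E c) (archFormOf E N₁ J₁) (archFormOf E N₂ J₂) u : unitaryGroupOfForm (conjMixed F E c) _) :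
      GL (Fin (N₁ + N₂)) (mixedSpace E)) : Matrix (Fin (N₁ + N₂)) (Fin (N₁ + N₂)) (mixedSpace E)) = _
  rw [coe_blockDiagFin, finSum, Matrix.reindex_apply]

/-- `archBlockDiag` is injective. [cite: Rogawski1990, §3.8 Prop. 3.8.1 p. 27] -/
theorem archBlockDiag_injective : Function.Injective (archBlockDiag F E c J₁ J₂) := by
  intro u v h
  have h' := congrArg (fun k : arch F E c (N₁ + N₂) (finSum N₁ N₂ J₁ J₂) => (k : GL (Fin (N₁ + N₂)) (mixedSpace E))) h
  exact blockDiagFin_injective (conjMixed F E c) (archFormOf E N₁ J₁) (archFormOf E N₂ J₂) (Subtype.ext h')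

/-- `archBlockDiag` is continuous. [cite: Rogawski1990, §3.8 Prop. 3.8.1 p. 27] -/
theorem continuous_archBlockDiag : Continuous (archBlockDiag F E c J₁ J₂) :=
  (continuous_inclusion (arch_finSum_ge F E c J₁ J₂)).comp (continuous_blockDiagFin (conjMixed F E c) (archFormOf E N₁ J₁) (archFormOf E N₂ J₂))

end BlockDiag

/-! ## §2 Frames: `(u₁, u₂) ↦ T (u₁ ⊕ᶠ u₂) T⁻¹` onto the centraliser of `γ = T (a·1 ⊕ᶠ b·1) T⁻¹` -/

section Frame

variable (F E : Type) [Field F] [Field E] [Algebra F E] (c : E ≃ₐ[F] E) {N₁ N₂ : ℕ}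
  {J : Matrix (Fin (N₁ + N₂)) (Fin (N₁ + N₂)) E} {J₁ : Matrix (Fin N₁) (Fin N₁) E} {J₂ : Matrix (Fin N₂) (Fin N₂) E}

variable {F E c}

/-- **The frame embedding** `U(J₁)(E ⊗ ℝ) × U(J₂)(E ⊗ ℝ) →* U(J)(E ⊗ ℝ)`, `(u₁, u₂) ↦ T (u₁ ⊕ᶠ u₂) T⁻¹`, for an archimedean congruence `σ(T)ᵀ J′ T = (J₁ ⊕ᶠ J₂)′`
(★ `unitaryGroupOfFormCongrOfEq` ∘ `archBlockDiag`). [cite: Rogawski1990, §3.8 Prop. 3.8.1 p. 27] -/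
def archFrameEmbedding (T : GL (Fin (N₁ + N₂)) (mixedSpace E))
    (hT : formCongr (conjMixed F E c) T (archFormOf E (N₁ + N₂) J) = archFormOf E (N₁ + N₂) (finSum N₁ N₂ J₁ J₂)) :
    arch F E c N₁ J₁ × arch F E c N₂ J₂ →* arch F E c (N₁ + N₂) J :=
  (unitaryGroupOfFormCongrOfEq (conjMixed F E c) T (archFormOf E (N₁ + N₂) J) (archFormOf E (N₁ + N₂) (finSum N₁ N₂ J₁ J₂)) hT).toMulEquiv.toMonoidHom.comp
    (archBlockDiag F E c J₁ J₂)

/-- `archFrameEmbedding T hT u = T · (u₁ ⊕ᶠ u₂) · T⁻¹` in `GL`. [cite: Rogawski1990, §3.8 Prop. 3.8.1 p. 27] -/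
theorem coe_archFrameEmbedding (T : GL (Fin (N₁ + N₂)) (mixedSpace E))
    (hT : formCongr (conjMixed F E c) T (archFormOf E (N₁ + N₂) J) = archFormOf E (N₁ + N₂) (finSum N₁ N₂ J₁ J₂)) (u : arch F E c N₁ J₁ × arch F E c N₂ J₂) :
    ((archFrameEmbedding T hT u : arch F E c (N₁ + N₂) J) : GL (Fin (N₁ + N₂)) (mixedSpace E)) =
      T * ((archBlockDiag F E c J₁ J₂ u : arch F E c (N₁ + N₂) (finSum N₁ N₂ J₁ J₂)) : GL (Fin (N₁ + N₂)) (mixedSpace E)) * T⁻¹ :=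
  rfl

/-- `archFrameEmbedding` is injective. [cite: Rogawski1990, §3.8 Prop. 3.8.1 p. 27] -/
theorem archFrameEmbedding_injective (T : GL (Fin (N₁ + N₂)) (mixedSpace E))
    (hT : formCongr (conjMixed F E c) T (archFormOf E (N₁ + N₂) J) = archFormOf E (N₁ + N₂) (finSum N₁ N₂ J₁ J₂)) :
    Function.Injective (archFrameEmbedding T hT) :=
  (unitaryGroupOfFormCongrOfEq (conjMixed F E c) T (archFormOf E (N₁ + N₂) J) (archFormOf E (N₁ + N₂) (finSum N₁ N₂ J₁ J₂)) hT).injective.comp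
    (archBlockDiag_injective F E c J₁ J₂)

/-- `archFrameEmbedding` is continuous. [cite: Rogawski1990, §3.8 Prop. 3.8.1 p. 27] -/
theorem continuous_archFrameEmbedding (T : GL (Fin (N₁ + N₂)) (mixedSpace E))
    (hT : formCongr (conjMixed F E c) T (archFormOf E (N₁ + N₂) J) = archFormOf E (N₁ + N₂) (finSum N₁ N₂ J₁ J₂)) :
    Continuous (archFrameEmbedding T hT) :=
  (unitaryGroupOfFormCongrOfEq (conjMixed F E c) T (archFormOf E (N₁ + N₂) J) (archFormOf E (N₁ + N₂) (finSum N₁ N₂ J₁ J₂)) hT).continuous.comp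
    (continuous_archBlockDiag F E c J₁ J₂)

/-- **The frame embedding lands in the centraliser of `γ = T (a·1 ⊕ᶠ b·1) T⁻¹`** (block-diagonal matrices commute with block scalars, ★ `finSum_commute_finSum_smul_one`).
[cite: Rogawski1990, §3.8 Prop. 3.8.1 p. 27] -/
theorem archFrameEmbedding_mem_centralizer (T : GL (Fin (N₁ + N₂)) (mixedSpace E))
    (hT : formCongr (conjMixed F E c) T (archFormOf E (N₁ + N₂) J) = archFormOf E (N₁ + N₂) (finSum N₁ N₂ J₁ J₂)) {a b : mixedSpace E}
    (γ : arch F E c (N₁ + N₂) J)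
    (hγ : ((γ : GL (Fin (N₁ + N₂)) (mixedSpace E)) : Matrix (Fin (N₁ + N₂)) (Fin (N₁ + N₂)) (mixedSpace E)) * (T : Matrix (Fin (N₁ + N₂)) (Fin (N₁ + N₂)) (mixedSpace E)) =
      (T : Matrix (Fin (N₁ + N₂)) (Fin (N₁ + N₂)) (mixedSpace E)) * finSum N₁ N₂ (a • (1 : Matrix (Fin N₁) (Fin N₁) (mixedSpace E))) (b • 1))
    (u : arch F E c N₁ J₁ × arch F E c N₂ J₂) :
    archFrameEmbedding T hT u ∈ Subgroup.centralizer ({γ} : Set (arch F E c (N₁ + N₂) J)) := by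
  rw [Subgroup.mem_centralizer_iff]
  intro k hk
  rw [Set.mem_singleton_iff] at hk
  rw [hk]
  -- read in matrices
  apply Subtype.ext
  apply Units.ext
  set Tm : Matrix (Fin (N₁ + N₂)) (Fin (N₁ + N₂)) (mixedSpace E) := (T : Matrix (Fin (N₁ + N₂)) (Fin (N₁ + N₂)) (mixedSpace E)) with hTm
  set Ti : Matrix (Fin (N₁ + N₂)) (Fin (N₁ + N₂)) (mixedSpace E) := ((T⁻¹ : GL (Fin (N₁ + N₂)) (mixedSpace E)) : Matrix (Fin (N₁ + N₂)) (Fin (N₁ + N₂)) (mixedSpace E))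
    with hTi
  have hTT : Tm * Ti = 1 := by rw [hTm, hTi, ← Units.val_mul, mul_inv_cancel, Units.val_one]
  have hTT' : Ti * Tm = 1 := by rw [hTm, hTi, ← Units.val_mul, inv_mul_cancel, Units.val_one]
  set D := finSum N₁ N₂ (a • (1 : Matrix (Fin N₁) (Fin N₁) (mixedSpace E))) (b • 1) with hD
  set B := (((archBlockDiag F E c J₁ J₂ u : arch F E c (N₁ + N₂) (finSum N₁ N₂ J₁ J₂)) : GL (Fin (N₁ + N₂)) (mixedSpace E)) :
    Matrix (Fin (N₁ + N₂)) (Fin (N₁ + N₂)) (mixedSpace E)) with hB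
  have hBD : B * D = D * B := by
    rw [hB, coe_coe_archBlockDiag, hD]
    exact finSum_commute_finSum_smul_one a b _ _
  -- `γ = T D T⁻¹`
  have hγ' : ((γ : GL (Fin (N₁ + N₂)) (mixedSpace E)) : Matrix (Fin (N₁ + N₂)) (Fin (N₁ + N₂)) (mixedSpace E)) = Tm * D * Ti := by
    rw [← hγ, Matrix.mul_assoc, hTT, Matrix.mul_one]
  change ((γ : GL (Fin (N₁ + N₂)) (mixedSpace E)) : Matrix (Fin (N₁ + N₂)) (Fin (N₁ + N₂)) (mixedSpace E)) * (Tm * B * Ti) =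
    (Tm * B * Ti) * ((γ : GL (Fin (N₁ + N₂)) (mixedSpace E)) : Matrix (Fin (N₁ + N₂)) (Fin (N₁ + N₂)) (mixedSpace E))
  rw [hγ']
  calc Tm * D * Ti * (Tm * B * Ti) = Tm * D * (Ti * Tm) * B * Ti := by simp only [Matrix.mul_assoc]
    _ = Tm * (D * B) * Ti := by rw [hTT', Matrix.mul_one]; simp only [Matrix.mul_assoc]
    _ = Tm * (B * D) * Ti := by rw [hBD]
    _ = Tm * B * (Ti * Tm) * D * Ti := by rw [hTT', Matrix.mul_one]; simp only [Matrix.mul_assoc]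
    _ = Tm * B * Ti * (Tm * D * Ti) := by simp only [Matrix.mul_assoc]

end Frame

/-! ## §3 The measure of a frame on the centraliser -/

section FrameMeasure

variable (F E : Type) [Field F] [Field E] [Algebra F E] (c : E ≃ₐ[F] E) {N₁ N₂ : ℕ}
  {J : Matrix (Fin (N₁ + N₂)) (Fin (N₁ + N₂)) E} {J₁ : Matrix (Fin N₁) (Fin N₁) E} {J₂ : Matrix (Fin N₂) (Fin N₂) E}

variable {F E c}

/-- **The measure of a frame on `Z(γ)`**: the push-forward of `μ₁ ⊗ μ₂` along `(u₁, u₂) ↦ T (u₁ ⊕ᶠ u₂) T⁻¹` (with values in the centraliser; for Haar `μ₁, μ₂` and `a − b`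
a unit this is a Haar measure on `Z(γ)`, sequel B2b). [cite: Rogawski1990, §1.7 p. 6; §3.8 Prop. 3.8.1 (a) p. 27] -/
def centralizerMeasureOfFrame (T : GL (Fin (N₁ + N₂)) (mixedSpace E))
    (hT : formCongr (conjMixed F E c) T (archFormOf E (N₁ + N₂) J) = archFormOf E (N₁ + N₂) (finSum N₁ N₂ J₁ J₂)) {a b : mixedSpace E}
    (γ : arch F E c (N₁ + N₂) J)
    (hγ : ((γ : GL (Fin (N₁ + N₂)) (mixedSpace E)) : Matrix (Fin (N₁ + N₂)) (Fin (N₁ + N₂)) (mixedSpace E)) * (T : Matrix (Fin (N₁ + N₂)) (Fin (N₁ + N₂)) (mixedSpace E)) =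
      (T : Matrix (Fin (N₁ + N₂)) (Fin (N₁ + N₂)) (mixedSpace E)) * finSum N₁ N₂ (a • (1 : Matrix (Fin N₁) (Fin N₁) (mixedSpace E))) (b • 1))
    [MeasurableSpace (arch F E c N₁ J₁)] [MeasurableSpace (arch F E c N₂ J₂)] [MeasurableSpace (Subgroup.centralizer ({γ} : Set (arch F E c (N₁ + N₂) J)))]
    (μ₁ : Measure (arch F E c N₁ J₁)) (μ₂ : Measure (arch F E c N₂ J₂)) : Measure (Subgroup.centralizer ({γ} : Set (arch F E c (N₁ + N₂) J))) :=
  Measure.map (fun u : arch F E c N₁ J₁ × arch F E c N₂ J₂ =>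
      (⟨archFrameEmbedding T hT u, archFrameEmbedding_mem_centralizer T hT γ hγ u⟩ : Subgroup.centralizer ({γ} : Set (arch F E c (N₁ + N₂) J))))
    (μ₁.prod μ₂)

/-- Unfolding `centralizerMeasureOfFrame`. [cite: Rogawski1990, §1.7 p. 6] -/
theorem centralizerMeasureOfFrame_def (T : GL (Fin (N₁ + N₂)) (mixedSpace E))
    (hT : formCongr (conjMixed F E c) T (archFormOf E (N₁ + N₂) J) = archFormOf E (N₁ + N₂) (finSum N₁ N₂ J₁ J₂)) {a b : mixedSpace E}
    (γ : arch F E c (N₁ + N₂) J)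
    (hγ : ((γ : GL (Fin (N₁ + N₂)) (mixedSpace E)) : Matrix (Fin (N₁ + N₂)) (Fin (N₁ + N₂)) (mixedSpace E)) * (T : Matrix (Fin (N₁ + N₂)) (Fin (N₁ + N₂)) (mixedSpace E)) =
      (T : Matrix (Fin (N₁ + N₂)) (Fin (N₁ + N₂)) (mixedSpace E)) * finSum N₁ N₂ (a • (1 : Matrix (Fin N₁) (Fin N₁) (mixedSpace E))) (b • 1))
    [MeasurableSpace (arch F E c N₁ J₁)] [MeasurableSpace (arch F E c N₂ J₂)] [MeasurableSpace (Subgroup.centralizer ({γ} : Set (arch F E c (N₁ + N₂) J)))]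
    (μ₁ : Measure (arch F E c N₁ J₁)) (μ₂ : Measure (arch F E c N₂ J₂)) :
    centralizerMeasureOfFrame T hT γ hγ μ₁ μ₂ =
      Measure.map (fun u : arch F E c N₁ J₁ × arch F E c N₂ J₂ =>
        (⟨archFrameEmbedding T hT u, archFrameEmbedding_mem_centralizer T hT γ hγ u⟩ : Subgroup.centralizer ({γ} : Set (arch F E c (N₁ + N₂) J)))) (μ₁.prod μ₂) :=
  rfl

end FrameMeasure

/-! ## §4 The CM centraliser measure: `|ω_std|_{M₂} ⊗ |ω_std|_{M₁}` through a chosen frame -/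

section CM

variable (L : Type) [Field L] [NumberField L] [IsCMField L] (H : Matrix (Fin 3) (Fin 3) L)

/-- **An archimedean singular frame of `γ ∈ U(H)(L⁺ ⊗ ℝ)`**: eigenvalues `a ≠ b ∈ L`, `T ∈ GL₃(L ⊗ ℝ)`, RATIONAL `c`-hermitian non-degenerate blocks `H_a ∈ M₂(L)`,
`H_b ∈ M₁(L)` with `σ(T)ᵀ H′ T = (H_a ⊕ᶠ H_b)′` and `γ T = T (a·1 ⊕ᶠ b·1)′`.  The rational frames of ★ `exists_singular_frame_of_isSemisimpleElt` (for `γ` rational singular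
semisimple non-scalar, base-changed by `mixedEmbedding`) and their `U(H)(L⁺ ⊗ ℝ)`-conjugates are such frames. [cite: Rogawski1990, §3.8 Prop. 3.8.1 (a) p. 27] -/
def IsSingularArchFrame (γ : arch (↥(maximalRealSubfield L)) L (IsCMField.complexConj L) 3 H) (a b : L) (T : GL (Fin 3) (mixedSpace L))
    (H_a : Matrix (Fin 2) (Fin 2) L) (H_b : Matrix (Fin 1) (Fin 1) L) : Prop :=
  a ≠ b ∧ (H_a.map (IsCMField.complexConj L))ᵀ = H_a ∧ (H_b.map (IsCMField.complexConj L))ᵀ = H_b ∧ IsUnit H_a.det ∧ IsUnit H_b.det ∧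
    formCongr (conjMixed (↥(maximalRealSubfield L)) L (IsCMField.complexConj L)) T (archFormOf L 3 H) = archFormOf L 3 (finSum 2 1 H_a H_b) ∧
    ((γ : GL (Fin 3) (mixedSpace L)) : Matrix (Fin 3) (Fin 3) (mixedSpace L)) * (T : Matrix (Fin 3) (Fin 3) (mixedSpace L)) =
      (T : Matrix (Fin 3) (Fin 3) (mixedSpace L)) * finSum 2 1 (mixedEmbedding L a • (1 : Matrix (Fin 2) (Fin 2) (mixedSpace L))) (mixedEmbedding L b • 1)

variable {L H}

/-- Unfolding `IsSingularArchFrame`. [cite: Rogawski1990, §3.8 Prop. 3.8.1 (a) p. 27] -/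
theorem isSingularArchFrame_iff (γ : arch (↥(maximalRealSubfield L)) L (IsCMField.complexConj L) 3 H) (a b : L) (T : GL (Fin 3) (mixedSpace L))
    (H_a : Matrix (Fin 2) (Fin 2) L) (H_b : Matrix (Fin 1) (Fin 1) L) :
    IsSingularArchFrame L H γ a b T H_a H_b ↔
      a ≠ b ∧ (H_a.map (IsCMField.complexConj L))ᵀ = H_a ∧ (H_b.map (IsCMField.complexConj L))ᵀ = H_b ∧ IsUnit H_a.det ∧ IsUnit H_b.det ∧
        formCongr (conjMixed (↥(maximalRealSubfield L)) L (IsCMField.complexConj L)) T (archFormOf L 3 H) = archFormOf L 3 (finSum 2 1 H_a H_b) ∧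
        ((γ : GL (Fin 3) (mixedSpace L)) : Matrix (Fin 3) (Fin 3) (mixedSpace L)) * (T : Matrix (Fin 3) (Fin 3) (mixedSpace L)) =
          (T : Matrix (Fin 3) (Fin 3) (mixedSpace L)) * finSum 2 1 (mixedEmbedding L a • (1 : Matrix (Fin 2) (Fin 2) (mixedSpace L))) (mixedEmbedding L b • 1) :=
  Iff.rfl

variable (L H) in
/-- **THE TOP-FORM HAAR MEASURE OF THE ARCHIMEDEAN CENTRALISER** `Z(γ) ⊂ U(H)(L⁺ ⊗ ℝ)`: if `γ` admits a singular archimedean frame, the measure of a CHOSEN frame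
`(a, b, T, H_a, H_b)` for the block measures `archTopFormHaar H_a ⊗ archTopFormHaar H_b` = `|ω_std|_{M₂} ⊗ |ω_std|_{M₁}` (Borel structures on the blocks); `0` if no
frame exists (junk, never read: (K7-s) quantifies over singular non-central semisimple classes).  Frame independence and the Haar property: sequel B2b.  This is print's
«compatible measure» on `G_γ(ℝ) ≅ U(h)(ℝ) × U(1)` [Rogawski1990 §1.7 p. 6, §3.8], the `∞`-component of the measures the identity (K7-s) [§14.5 p. 239; Kottwitz1988 Prop. 2]
compares across inner forms. [cite: Rogawski1990, §1.7 p. 6; §3.8 Prop. 3.8.1 (a) p. 27; §14.5 Lemma 14.5.2 (b) pp. 238–239] [cite: Helgason2000, Ch. I §1 Thm. 1.14 p. 96] -/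
def centralizerTopFormHaar (γ : arch (↥(maximalRealSubfield L)) L (IsCMField.complexConj L) 3 H)
    [MeasurableSpace (Subgroup.centralizer ({γ} : Set (arch (↥(maximalRealSubfield L)) L (IsCMField.complexConj L) 3 H)))] :
    Measure (Subgroup.centralizer ({γ} : Set (arch (↥(maximalRealSubfield L)) L (IsCMField.complexConj L) 3 H))) :=
  if h : ∃ (a b : L) (T : GL (Fin 3) (mixedSpace L)) (H_a : Matrix (Fin 2) (Fin 2) L) (H_b : Matrix (Fin 1) (Fin 1) L), IsSingularArchFrame L H γ a b T H_a H_b then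
    letI : MeasurableSpace (arch (↥(maximalRealSubfield L)) L (IsCMField.complexConj L) 2 h.choose_spec.choose_spec.choose_spec.choose) := borel _
    haveI : BorelSpace (arch (↥(maximalRealSubfield L)) L (IsCMField.complexConj L) 2 h.choose_spec.choose_spec.choose_spec.choose) := ⟨rfl⟩
    letI : MeasurableSpace (archSkew (↥(maximalRealSubfield L)) L (IsCMField.complexConj L) 2 h.choose_spec.choose_spec.choose_spec.choose) := borel _
    haveI : BorelSpace (archSkew (↥(maximalRealSubfield L)) L (IsCMField.complexConj L) 2 h.choose_spec.choose_spec.choose_spec.choose) := ⟨rfl⟩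
    letI : MeasurableSpace (arch (↥(maximalRealSubfield L)) L (IsCMField.complexConj L) 1 h.choose_spec.choose_spec.choose_spec.choose_spec.choose) := borel _
    haveI : BorelSpace (arch (↥(maximalRealSubfield L)) L (IsCMField.complexConj L) 1 h.choose_spec.choose_spec.choose_spec.choose_spec.choose) := ⟨rfl⟩
    letI : MeasurableSpace (archSkew (↥(maximalRealSubfield L)) L (IsCMField.complexConj L) 1 h.choose_spec.choose_spec.choose_spec.choose_spec.choose) := borel _
    haveI : BorelSpace (archSkew (↥(maximalRealSubfield L)) L (IsCMField.complexConj L) 1 h.choose_spec.choose_spec.choose_spec.choose_spec.choose) := ⟨rfl⟩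
    centralizerMeasureOfFrame h.choose_spec.choose_spec.choose h.choose_spec.choose_spec.choose_spec.choose_spec.choose_spec.2.2.2.2.2.1 γ
      h.choose_spec.choose_spec.choose_spec.choose_spec.choose_spec.2.2.2.2.2.2
      (archTopFormHaar (↥(maximalRealSubfield L)) L (IsCMField.complexConj L) 2 h.choose_spec.choose_spec.choose_spec.choose)
      (archTopFormHaar (↥(maximalRealSubfield L)) L (IsCMField.complexConj L) 1 h.choose_spec.choose_spec.choose_spec.choose_spec.choose)
  else 0

end CM

end UnitaryArchTopForm

end Literature.NumberTheory.Weil1964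

end
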